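import Summits.QuantumFields.YangMills.Theses.TransportPerturbation
import HarnessLib

/-!
# Route `TransportPerturbation`, LINE 10 «harris_hybrid»: `WeakHarrisOneStep` (stmt-QuantumFields-27870) — PROVED

Seat `ym-line-csu-p1` (g4).  The one-step weak Harris theorem in dual (Lipschitz) form with explicit constants
(Hairer–Mattingly–Scheutzow, arXiv:0902.4495, Thm 4.8 and its proof): `c = min(1/2, (1−α)/2, η/2)`, `β = c/(2b)`,
`κ = √q`, `q = max((1+α)/2, 1 − η/2, (1 + 5c/4)/(1 + 2c))`.  One step: for a coupling `(T, T')` of `Q(x,·), Q(y,·)`,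
`|Qg x − Qg y| ≤ A E √(d(T,T') w(T,T')) ≤ A √(E d(T,T')) √(1 + βQV x + βQV y)` (Cauchy–Schwarz,
`coupling_lipschitz_bound`), and the three HMS cases (`d < 1` / `d = 1, V x + V y ≥ 4b` / `d = 1, V x, V y ≤ 4b`)
give `E d · (1 + βQV x + βQV y) ≤ q · d(x,y) (1 + βV x + βV y)` (`hms_case_arith`); iterate (`contraction_step`).
Lyapunov part: `Q^m V ≤ V/8^m + (8b/7)(1 − 8^{−m})` (`lyapunov_iterate`).  No sorry; standard axioms.
RECORD-rung plumbing for LINE 10; nothing here bears on the mass gap, which is NOT proved.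
-/

set_option autoImplicit false

noncomputable section

namespace Summit.QuantumFields.YangMills.Theorems.TransportPerturbation

open MeasureTheory ProbabilityTheory Filter Topology
open scoped NNReal ENNReal BigOperators
open Literature.MathematicalPhysics.QuantumFieldTheory

section Operator

variable {X Ω : Type} [MeasurableSpace X] [MeasurableSpace Ω] (U : X → ℝ≥0 → Ω → X) (P : Measure Ω)
  [IsProbabilityMeasure P] (t : ℝ≥0)

/-- `Q f` is measurable for measurable `f` and a jointly measurable random map. [folklore] -/
theorem measurable_markovTransition' (hU : Measurable fun p : X × Ω => U p.1 t p.2) {f : X → ℝ}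
    (hf : Measurable f) : Measurable (markovTransition U P t f) := by
  have h : StronglyMeasurable fun p : X × Ω => f (U p.1 t p.2) := (hf.comp hU).stronglyMeasurable
  have h2 := h.integral_prod_right' (ν := P)
  exact h2.measurable

omit [MeasurableSpace X] in
/-- `|Q f| ≤ M` when `|f| ≤ M` (probability space). [folklore] -/
theorem abs_markovTransition_le {f : X → ℝ} {M : ℝ} (hM : ∀ x, |f x| ≤ M) (x : X) :
    |markovTransition U P t f x| ≤ M := by
  have h := norm_integral_le_of_norm_le_const (μ := P) (f := fun ω => f (U x t ω)) (C := M)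
    (Eventually.of_forall fun ω => by simpa [Real.norm_eq_abs] using hM (U x t ω))
  simpa [markovTransition, Real.norm_eq_abs] using h

omit [MeasurableSpace X] [IsProbabilityMeasure P] in
/-- `0 ≤ Q f` when `0 ≤ f`. [folklore] -/
theorem markovTransition_nonneg {f : X → ℝ} (hf : ∀ x, 0 ≤ f x) (x : X) : 0 ≤ markovTransition U P t f x :=
  integral_nonneg fun _ => hf _

/-- Integrability of a bounded measurable observable along the random map. [folklore] -/
theorem integrable_comp_randomMap (hU : Measurable fun p : X × Ω => U p.1 t p.2) {f : X → ℝ} (hf : Measurable f)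
    {M : ℝ} (hM : ∀ x, |f x| ≤ M) (x : X) : Integrable (fun ω => f (U x t ω)) P := by
  have hm : Measurable fun ω => U x t ω := hU.comp measurable_prodMk_left
  exact (integrable_const M).mono' ((hf.comp hm).aestronglyMeasurable)
    (Eventually.of_forall fun ω => by simpa [Real.norm_eq_abs] using hM (U x t ω))

/-- Monotonicity of `Q` on bounded measurable functions. [folklore] -/
theorem markovTransition_mono (hU : Measurable fun p : X × Ω => U p.1 t p.2) {f g : X → ℝ} (hf : Measurable f)
    (hg : Measurable g) {Mf Mg : ℝ} (hMf : ∀ x, |f x| ≤ Mf) (hMg : ∀ x, |g x| ≤ Mg) (hle : ∀ x, f x ≤ g x) (x : X) :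
    markovTransition U P t f x ≤ markovTransition U P t g x :=
  integral_mono (integrable_comp_randomMap U P t hU hf hMf x) (integrable_comp_randomMap U P t hU hg hMg x)
    fun _ => hle _

/-- `Q (a·f + c) = a·Q f + c` for bounded measurable `f` (probability space). [folklore] -/
theorem markovTransition_affine (hU : Measurable fun p : X × Ω => U p.1 t p.2) {f : X → ℝ} (hf : Measurable f)
    {M : ℝ} (hM : ∀ x, |f x| ≤ M) (a c : ℝ) (x : X) :
    markovTransition U P t (fun y => a * f y + c) x = a * markovTransition U P t f x + c := by
  simp only [markovTransition]
  rw [integral_add ((integrable_comp_randomMap U P t hU hf hM x).const_mul a) (integrable_const c),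
    integral_const_mul, integral_const]
  simp

end Operator

/-- **Cauchy–Schwarz for `√(f g)`**: `∫ √(f·g) ≤ √(∫ f) · √(∫ g)` for bounded measurable `f, g ≥ 0` on a finite
measure space. [folklore] -/
theorem integral_sqrt_mul_le {Ω : Type} [MeasurableSpace Ω] (μ : Measure Ω) [IsFiniteMeasure μ] {f g : Ω → ℝ}
    (hf : Measurable f) (hg : Measurable g) (hf0 : ∀ ω, 0 ≤ f ω) (hg0 : ∀ ω, 0 ≤ g ω) {Mf Mg : ℝ}
    (hMf : ∀ ω, f ω ≤ Mf) (hMg : ∀ ω, g ω ≤ Mg) :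
    ∫ ω, Real.sqrt (f ω * g ω) ∂μ ≤ Real.sqrt (∫ ω, f ω ∂μ) * Real.sqrt (∫ ω, g ω ∂μ) := by
  have h1 : ∀ ω, Real.sqrt (f ω * g ω) = Real.sqrt (f ω) * Real.sqrt (g ω) := fun ω => Real.sqrt_mul (hf0 ω) _
  simp_rw [h1]
  have hF : MemLp (fun ω => Real.sqrt (f ω)) (ENNReal.ofReal 2) μ :=
    MemLp.of_bound (hf.sqrt.aestronglyMeasurable) (Real.sqrt Mf)
      (Eventually.of_forall fun ω => by
        rw [Real.norm_eq_abs, abs_of_nonneg (Real.sqrt_nonneg _)]; exact Real.sqrt_le_sqrt (hMf ω))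
  have hG : MemLp (fun ω => Real.sqrt (g ω)) (ENNReal.ofReal 2) μ :=
    MemLp.of_bound (hg.sqrt.aestronglyMeasurable) (Real.sqrt Mg)
      (Eventually.of_forall fun ω => by
        rw [Real.norm_eq_abs, abs_of_nonneg (Real.sqrt_nonneg _)]; exact Real.sqrt_le_sqrt (hMg ω))
  have h := integral_mul_le_Lp_mul_Lq_of_nonneg Real.HolderConjugate.two_two
    (Eventually.of_forall fun ω => Real.sqrt_nonneg (f ω)) (Eventually.of_forall fun ω => Real.sqrt_nonneg (g ω)) hF hG
  have h2 : ∀ ω, Real.sqrt (f ω) ^ (2 : ℝ) = f ω := fun ω => by rw [Real.rpow_two, Real.sq_sqrt (hf0 ω)]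
  have h3 : ∀ ω, Real.sqrt (g ω) ^ (2 : ℝ) = g ω := fun ω => by rw [Real.rpow_two, Real.sq_sqrt (hg0 ω)]
  simp_rw [h2, h3] at h
  rwa [← Real.sqrt_eq_rpow, ← Real.sqrt_eq_rpow] at h

/-- **Lyapunov iterates**: `Q V ≤ V/8 + b` for bounded measurable `V ≥ 0` gives, for all `m`,
`Q^m V` measurable, `0 ≤ Q^m V ≤ V/8^m + (8b/7)(1 − 8^{−m})`. [cite: HairerMattinglyScheutzow2011, §4 (proof of Thm 4.8)] -/
theorem lyapunov_iterate {X Ω : Type} [MeasurableSpace X] [MeasurableSpace Ω] (U : X → ℝ≥0 → Ω → X) (P : Measure Ω)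
    [IsProbabilityMeasure P] (t : ℝ≥0) (hU : Measurable fun p : X × Ω => U p.1 t p.2) {V : X → ℝ}
    (hVm : Measurable V) (hV0 : ∀ x, 0 ≤ V x) {M : ℝ} (hVM : ∀ x, V x ≤ M) {b : ℝ} (hb : 0 ≤ b)
    (hdrift : ∀ x, markovTransition U P t V x ≤ V x / 8 + b) (m : ℕ) :
    Measurable ((markovTransition U P t)^[m] V) ∧ (∀ x, 0 ≤ ((markovTransition U P t)^[m] V) x) ∧
      ∀ x, ((markovTransition U P t)^[m] V) x ≤ V x / 8 ^ m + 8 * b / 7 * (1 - 1 / 8 ^ m) := by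
  have hVabs : ∀ x, |V x| ≤ M := fun x => by rw [abs_of_nonneg (hV0 x)]; exact hVM x
  induction m with
  | zero =>
    refine ⟨by simpa using hVm, fun x => by simpa using hV0 x, fun x => ?_⟩
    simp
  | succ n ih =>
    obtain ⟨ihm, ih0, ihb⟩ := ih
    have h8n : (1 : ℝ) ≤ 8 ^ n := one_le_pow₀ (by norm_num); have h8n0 : (0 : ℝ) < 8 ^ n := by positivity
    have hgeom : (0 : ℝ) ≤ 1 - 1 / 8 ^ n := by rw [sub_nonneg, div_le_one h8n0]; exact h8n
    have hbdn : ∀ x, |((markovTransition U P t)^[n] V) x| ≤ M + 8 * b / 7 := fun x => by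
      rw [abs_of_nonneg (ih0 x)]
      refine (ihb x).trans (add_le_add ?_ ?_)
      · exact (div_le_self (hV0 x) h8n).trans (hVM x)
      · have : 8 * b / 7 * (1 - 1 / 8 ^ n) ≤ 8 * b / 7 * 1 :=
          mul_le_mul_of_nonneg_left (by rw [sub_le_self_iff]; positivity) (by positivity)
        linarith
    refine ⟨?_, ?_, fun x => ?_⟩
    · rw [Function.iterate_succ']
      exact measurable_markovTransition' U P t hU ihm
    · intro x
      rw [Function.iterate_succ_apply']
      exact markovTransition_nonneg U P t ih0 x
    rw [Function.iterate_succ_apply']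
    set cn : ℝ := 8 * b / 7 * (1 - 1 / 8 ^ n) with hcn
    have haffm : Measurable fun y => 1 / 8 ^ n * V y + cn := (hVm.const_mul _).add_const _
    have haffb : ∀ y, |1 / 8 ^ n * V y + cn| ≤ M + 8 * b / 7 := fun y => by
      have h0 : 0 ≤ 1 / 8 ^ n * V y + cn := add_nonneg (mul_nonneg (by positivity) (hV0 y)) (by positivity)
      rw [abs_of_nonneg h0]
      refine add_le_add ?_ ?_
      · calc 1 / 8 ^ n * V y ≤ 1 * V y := mul_le_mul_of_nonneg_right (by rw [div_le_one h8n0]; exact h8n) (hV0 y)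
          _ ≤ M := by rw [one_mul]; exact hVM y
      · have : 8 * b / 7 * (1 - 1 / 8 ^ n) ≤ 8 * b / 7 * 1 :=
          mul_le_mul_of_nonneg_left (by rw [sub_le_self_iff]; positivity) (by positivity)
        linarith
    have h1 : markovTransition U P t ((markovTransition U P t)^[n] V) x ≤
        markovTransition U P t (fun y => 1 / 8 ^ n * V y + cn) x :=
      markovTransition_mono U P t hU ihm haffm hbdn haffb (fun y => by
        have := ihb y
        rw [div_eq_mul_one_div, mul_comm] at this
        exact this) x
    have h2 : markovTransition U P t (fun y => 1 / 8 ^ n * V y + cn) x =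
        1 / 8 ^ n * markovTransition U P t V x + cn := markovTransition_affine U P t hU hVm hVabs _ _ x
    rw [h2] at h1
    calc markovTransition U P t ((markovTransition U P t)^[n] V) x ≤ 1 / 8 ^ n * markovTransition U P t V x + cn := h1
      _ ≤ 1 / 8 ^ n * (V x / 8 + b) + cn := by
          have := mul_le_mul_of_nonneg_left (hdrift x) (show (0 : ℝ) ≤ 1 / 8 ^ n by positivity)
          linarith
      _ = V x / 8 ^ (n + 1) + 8 * b / 7 * (1 - 1 / 8 ^ (n + 1)) := by
          rw [hcn, pow_succ]
          field_simp
          ring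

/-- **The coupling bound** (the dual Lipschitz step of HMS): for a coupling `(T₁, T₂)` of `Q(x,·), Q(y,·)`, `g` in the
class `{|g| ≤ 1, |g x − g y| ≤ A √(d(x,y)(1 + βV x + βV y))}` and bounded measurable `V ≥ 0`,
`|Qg x − Qg y| ≤ A · √(E d(T₁,T₂) · (1 + β QV x + β QV y))` (Cauchy–Schwarz).
[cite: HairerMattinglyScheutzow2011, §4 (proof of Thm 4.8)] -/
theorem coupling_lipschitz_bound {X Ω Ω₁ : Type} [MeasurableSpace X] [MeasurableSpace Ω] [MeasurableSpace Ω₁]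
    (U : X → ℝ≥0 → Ω → X) (P : Measure Ω) (t : ℝ≥0)
    (P₁ : Measure Ω₁) (T₁ T₂ : X → X → Ω₁ → X)
    (hcpl : IsProbabilityMeasure P₁ ∧ Measurable (fun p : (X × X) × Ω₁ => T₁ p.1.1 p.1.2 p.2) ∧
      Measurable (fun p : (X × X) × Ω₁ => T₂ p.1.1 p.1.2 p.2) ∧
      ∀ f : X → ℝ, Measurable f → (∃ M : ℝ, ∀ x, |f x| ≤ M) → ∀ x y,
        (∫ ω, f (T₁ x y ω) ∂P₁) = markovTransition U P t f x ∧ (∫ ω, f (T₂ x y ω) ∂P₁) = markovTransition U P t f y)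
    {V : X → ℝ} (hVm : Measurable V) (hV0 : ∀ x, 0 ≤ V x) {M : ℝ} (hVM : ∀ x, V x ≤ M)
    {d : X → X → ℝ} (hdm : Measurable fun p : X × X => d p.1 p.2) (hd0 : ∀ x y, 0 ≤ d x y)
    (hd1 : ∀ x y, d x y ≤ 1) {β : ℝ} (hβ : 0 ≤ β) {A : ℝ} (hA : 0 ≤ A) {g : X → ℝ} (hgm : Measurable g)
    (hg1 : ∀ x, |g x| ≤ 1) (hlip : ∀ x y, |g x - g y| ≤ A * Real.sqrt (d x y * (1 + β * V x + β * V y)))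
    (x y : X) :
    |markovTransition U P t g x - markovTransition U P t g y| ≤
      A * Real.sqrt ((∫ ω, d (T₁ x y ω) (T₂ x y ω) ∂P₁) *
        (1 + β * markovTransition U P t V x + β * markovTransition U P t V y)) := by
  obtain ⟨hP₁, hT₁m, hT₂m, hmarg⟩ := hcpl
  have hT₁ : Measurable fun ω => T₁ x y ω := hT₁m.comp (measurable_prodMk_left (x := (x, y)))
  have hT₂ : Measurable fun ω => T₂ x y ω := hT₂m.comp (measurable_prodMk_left (x := (x, y)))
  have hVabs : ∀ z, |V z| ≤ M := fun z => by rw [abs_of_nonneg (hV0 z)]; exact hVM z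
  have hM0 : 0 ≤ M := (hV0 x).trans (hVM x)
  obtain ⟨hg₁, hg₂⟩ := hmarg g hgm ⟨1, hg1⟩ x y; obtain ⟨hV₁, hV₂⟩ := hmarg V hVm ⟨M, hVabs⟩ x y
  rw [← hg₁, ← hg₂, ← hV₁, ← hV₂]
  have ibd : ∀ (f : X → ℝ) (S : Ω₁ → X) (C : ℝ), Measurable f → Measurable S → (∀ z, |f z| ≤ C) →
      Integrable (fun ω => f (S ω)) P₁ := fun f S C hf hS hC => (integrable_const C).mono'
    ((hf.comp hS).aestronglyMeasurable) (Eventually.of_forall fun ω => by simpa [Real.norm_eq_abs] using hC _)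
  have ig1 := ibd g (fun ω => T₁ x y ω) 1 hgm hT₁ hg1; have ig2 := ibd g (fun ω => T₂ x y ω) 1 hgm hT₂ hg1
  have iV1 := ibd V (fun ω => T₁ x y ω) M hVm hT₁ hVabs; have iV2 := ibd V (fun ω => T₂ x y ω) M hVm hT₂ hVabs
  set w : Ω₁ → ℝ := fun ω => 1 + β * V (T₁ x y ω) + β * V (T₂ x y ω) with hw
  set e : Ω₁ → ℝ := fun ω => d (T₁ x y ω) (T₂ x y ω) with he
  have hem : Measurable e := hdm.comp (hT₁.prodMk hT₂)
  have hwm : Measurable w := (measurable_const.add ((hVm.comp hT₁).const_mul β)).add ((hVm.comp hT₂).const_mul β)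
  have he0 : ∀ ω, 0 ≤ e ω := fun ω => hd0 _ _; have he1 : ∀ ω, e ω ≤ 1 := fun ω => hd1 _ _
  have hw0 : ∀ ω, 0 ≤ w ω := fun ω => add_nonneg (add_nonneg zero_le_one (mul_nonneg hβ (hV0 _))) (mul_nonneg hβ (hV0 _))
  have hwM : ∀ ω, w ω ≤ 1 + β * M + β * M := fun ω =>
    add_le_add (add_le_add le_rfl (mul_le_mul_of_nonneg_left (hVM _) hβ)) (mul_le_mul_of_nonneg_left (hVM _) hβ)
  have hint_w : ∫ ω, w ω ∂P₁ = 1 + β * ∫ ω, V (T₁ x y ω) ∂P₁ + β * ∫ ω, V (T₂ x y ω) ∂P₁ := by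
    have i1 : Integrable (fun ω => (1 : ℝ) + β * V (T₁ x y ω)) P₁ := (integrable_const _).add (iV1.const_mul β)
    have i2 : Integrable (fun ω => β * V (T₂ x y ω)) P₁ := iV2.const_mul β
    have i3 : Integrable (fun ω => β * V (T₁ x y ω)) P₁ := iV1.const_mul β
    simp only [hw]
    rw [integral_add i1 i2, integral_add (integrable_const _) i3, integral_const_mul, integral_const_mul,
      integral_const]
    simp
  have ibound : Integrable (fun ω => A * Real.sqrt (e ω * w ω)) P₁ := by
    refine (integrable_const (A * Real.sqrt (1 * (1 + β * M + β * M)))).mono'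
      (((hem.mul hwm).sqrt.const_mul A).aestronglyMeasurable) (Eventually.of_forall fun ω => ?_)
    rw [Real.norm_eq_abs, abs_of_nonneg (mul_nonneg hA (Real.sqrt_nonneg _))]
    exact mul_le_mul_of_nonneg_left (Real.sqrt_le_sqrt (mul_le_mul (he1 ω) (hwM ω) (hw0 ω) zero_le_one)) hA
  calc |(∫ ω, g (T₁ x y ω) ∂P₁) - ∫ ω, g (T₂ x y ω) ∂P₁|
      = |∫ ω, (g (T₁ x y ω) - g (T₂ x y ω)) ∂P₁| := by rw [integral_sub ig1 ig2]
    _ ≤ ∫ ω, |g (T₁ x y ω) - g (T₂ x y ω)| ∂P₁ := abs_integral_le_integral_abs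
    _ ≤ ∫ ω, A * Real.sqrt (e ω * w ω) ∂P₁ := integral_mono (ig1.sub ig2).abs ibound fun ω => hlip _ _
    _ = A * ∫ ω, Real.sqrt (e ω * w ω) ∂P₁ := integral_const_mul _ _
    _ ≤ A * (Real.sqrt (∫ ω, e ω ∂P₁) * Real.sqrt (∫ ω, w ω ∂P₁)) :=
        mul_le_mul_of_nonneg_left (integral_sqrt_mul_le P₁ hem hwm he0 hw0 he1 hwM) hA
    _ = A * Real.sqrt ((∫ ω, e ω ∂P₁) * ∫ ω, w ω ∂P₁) := by rw [Real.sqrt_mul (integral_nonneg he0)]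
    _ = A * Real.sqrt ((∫ ω, d (T₁ x y ω) (T₂ x y ω) ∂P₁) *
        (1 + β * (∫ ω, V (T₁ x y ω) ∂P₁) + β * ∫ ω, V (T₂ x y ω) ∂P₁)) := by rw [hint_w]

/-- **The three HMS cases** (real arithmetic): with `c = 2βb`, `c ≤ (1−α)/2`, `c ≤ η/2` and
`q ≥ (1+α)/2, 1 − η/2, (1 + 5c/4)/(1 + 2c)`, the one-step Lyapunov bound `QV ≤ V/8 + b` and `E d ≤ 1` give
`E d · (1 + βQV x + βQV y) ≤ q · d(x,y) (1 + βV x + βV y)` in each case: `d(x,y) < 1, E d ≤ α d(x,y)`;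
`d(x,y) = 1, V x + V y ≥ 4b`; `d(x,y) = 1, E d ≤ 1 − η`. [cite: HairerMattinglyScheutzow2011, §4 (proof of Thm 4.8)] -/
theorem hms_case_arith {α η b c q e dxy Vx Vy Qx Qy β : ℝ} (hα0 : 0 ≤ α) (hα1 : α ≤ 1) (hc0 : 0 < c)
    (hcα : c ≤ (1 - α) / 2) (hcη : c ≤ η / 2)
    (hq1 : (1 + α) / 2 ≤ q) (hq2 : 1 - η / 2 ≤ q) (hq3 : (1 + 5 / 4 * c) / (1 + 2 * c) ≤ q)
    (hβ : 0 ≤ β) (hβc : 2 * β * b = c)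
    (hVx : 0 ≤ Vx) (hVy : 0 ≤ Vy) (hQx : Qx ≤ Vx / 8 + b) (hQy : Qy ≤ Vy / 8 + b) (hQx0 : 0 ≤ Qx) (hQy0 : 0 ≤ Qy)
    (he0 : 0 ≤ e) (he1 : e ≤ 1) (hd0 : 0 ≤ dxy)
    (hcase : (dxy < 1 ∧ e ≤ α * dxy) ∨ (dxy = 1 ∧ (4 * b ≤ Vx + Vy ∨ e ≤ 1 - η))) :
    e * (1 + β * Qx + β * Qy) ≤ q * (dxy * (1 + β * Vx + β * Vy)) := by
  -- `s = β (Vx + Vy) ≥ 0`, `R' = 1 + βQx + βQy ≤ R = 1 + s/8 + c`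
  have hs0 : 0 ≤ β * Vx + β * Vy := add_nonneg (mul_nonneg hβ hVx) (mul_nonneg hβ hVy)
  have hR'0 : 0 ≤ 1 + β * Qx + β * Qy := add_nonneg (add_nonneg zero_le_one (mul_nonneg hβ hQx0)) (mul_nonneg hβ hQy0)
  have hR'R : 1 + β * Qx + β * Qy ≤ 1 + (β * Vx + β * Vy) / 8 + c := by
    have h1 := mul_le_mul_of_nonneg_left hQx hβ
    have h2 := mul_le_mul_of_nonneg_left hQy hβ
    nlinarith
  have hq0 : 1 / 2 ≤ q := by linarith
  rcases hcase with ⟨hlt, heα⟩ | ⟨hd1, hS | heη⟩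
  · -- close pairs: contract by `α`
    have hαR : α * (1 + (β * Vx + β * Vy) / 8 + c) ≤ q * (1 + β * Vx + β * Vy) := by
      have h1 : α * (1 + c) ≤ (1 + α) / 2 := by nlinarith
      have h2 : α * ((β * Vx + β * Vy) / 8) ≤ q * (β * Vx + β * Vy) := by nlinarith
      nlinarith
    calc e * (1 + β * Qx + β * Qy) ≤ α * dxy * (1 + β * Qx + β * Qy) := mul_le_mul_of_nonneg_right heα hR'0
      _ ≤ α * dxy * (1 + (β * Vx + β * Vy) / 8 + c) := mul_le_mul_of_nonneg_left hR'R (mul_nonneg hα0 hd0)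
      _ = dxy * (α * (1 + (β * Vx + β * Vy) / 8 + c)) := by ring
      _ ≤ dxy * (q * (1 + β * Vx + β * Vy)) := mul_le_mul_of_nonneg_left hαR hd0
      _ = q * (dxy * (1 + β * Vx + β * Vy)) := by ring
  · -- far pairs away from the origin: the drift alone contracts
    subst hd1
    set q₃ : ℝ := (1 + 5 / 4 * c) / (1 + 2 * c) with hq₃
    have h2c : 0 < 1 + 2 * c := by linarith
    have hq₃id : q₃ * (1 + 2 * c) = 1 + 5 / 4 * c := by rw [hq₃]; field_simp
    have hq₃8 : 1 / 8 ≤ q₃ := by rw [hq₃, le_div_iff₀ h2c]; linarith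
    have hs2c : 2 * c ≤ β * Vx + β * Vy := by nlinarith
    have hR : 1 + (β * Vx + β * Vy) / 8 + c ≤ q₃ * (1 + (β * Vx + β * Vy)) := by
      nlinarith [mul_nonneg (sub_nonneg.2 hq₃8) (sub_nonneg.2 hs2c)]
    calc e * (1 + β * Qx + β * Qy) ≤ 1 * (1 + β * Qx + β * Qy) := mul_le_mul_of_nonneg_right he1 hR'0
      _ ≤ 1 + (β * Vx + β * Vy) / 8 + c := by linarith
      _ ≤ q₃ * (1 + (β * Vx + β * Vy)) := hR
      _ ≤ q * (1 + (β * Vx + β * Vy)) := mul_le_mul_of_nonneg_right hq3 (by linarith)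
      _ = q * (1 * (1 + β * Vx + β * Vy)) := by ring
  · -- far pairs near the origin: the small-set coupling contracts
    subst hd1
    have hη0 : 0 ≤ η := by linarith
    calc e * (1 + β * Qx + β * Qy) ≤ (1 - η) * (1 + β * Qx + β * Qy) := mul_le_mul_of_nonneg_right heη hR'0
      _ ≤ q * (1 * (1 + β * Vx + β * Vy)) := by
          rcases le_or_gt 0 (1 - η) with h | h
          · have h1 : (1 - η) * (1 + β * Qx + β * Qy) ≤ (1 - η) * (1 + (β * Vx + β * Vy) / 8 + c) :=
              mul_le_mul_of_nonneg_left hR'R h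
            have h2 : (1 - η) * (1 + c) ≤ 1 - η / 2 := by nlinarith
            have h3 : (1 - η) * ((β * Vx + β * Vy) / 8) ≤ q * (β * Vx + β * Vy) := by nlinarith
            nlinarith
          · have h1 : (1 - η) * (1 + β * Qx + β * Qy) ≤ 0 := mul_nonpos_of_nonpos_of_nonneg h.le hR'0
            nlinarith

/-- **One contraction step** (HMS Thm 4.8, dual form): under the hypotheses of `WeakHarrisOneStep` and the constants of
`hms_case_arith`, `Q` maps the class `{|g| ≤ 1, |g x − g y| ≤ A√(d(x,y)(1 + βV x + βV y))}` into the class with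
constant `√q · A`. [cite: HairerMattinglyScheutzow2011, Theorem 4.8] -/
theorem contraction_step {X Ω Ω₁ Ω₂ : Type} [MeasurableSpace X] [MeasurableSpace Ω] [MeasurableSpace Ω₁]
    [MeasurableSpace Ω₂] (U : X → ℝ≥0 → Ω → X) (P : Measure Ω) [IsProbabilityMeasure P] (t : ℝ≥0)
    (hU : Measurable fun p : X × Ω => U p.1 t p.2)
    (P₁ : Measure Ω₁) (T₁ T₂ : X → X → Ω₁ → X) (P₂ : Measure Ω₂) (T₃ T₄ : X → X → Ω₂ → X)
    (hcpl₁ : IsProbabilityMeasure P₁ ∧ Measurable (fun p : (X × X) × Ω₁ => T₁ p.1.1 p.1.2 p.2) ∧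
      Measurable (fun p : (X × X) × Ω₁ => T₂ p.1.1 p.1.2 p.2) ∧
      ∀ f : X → ℝ, Measurable f → (∃ M : ℝ, ∀ x, |f x| ≤ M) → ∀ x y,
        (∫ ω, f (T₁ x y ω) ∂P₁) = markovTransition U P t f x ∧ (∫ ω, f (T₂ x y ω) ∂P₁) = markovTransition U P t f y)
    (hcpl₂ : IsProbabilityMeasure P₂ ∧ Measurable (fun p : (X × X) × Ω₂ => T₃ p.1.1 p.1.2 p.2) ∧
      Measurable (fun p : (X × X) × Ω₂ => T₄ p.1.1 p.1.2 p.2) ∧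
      ∀ f : X → ℝ, Measurable f → (∃ M : ℝ, ∀ x, |f x| ≤ M) → ∀ x y,
        (∫ ω, f (T₃ x y ω) ∂P₂) = markovTransition U P t f x ∧ (∫ ω, f (T₄ x y ω) ∂P₂) = markovTransition U P t f y)
    {V : X → ℝ} {d : X → X → ℝ} (hVm : Measurable V) (hV0 : ∀ x, 0 ≤ V x) {M : ℝ} (hVM : ∀ x, V x ≤ M)
    (hdm : Measurable fun p : X × X => d p.1 p.2) (hd0 : ∀ x y, 0 ≤ d x y) (hd1 : ∀ x y, d x y ≤ 1)
    {α η b c q β : ℝ} (hα0 : 0 ≤ α) (hα1 : α ≤ 1) (hc0 : 0 < c) (hcα : c ≤ (1 - α) / 2) (hcη : c ≤ η / 2)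
    (hq0 : 0 ≤ q) (hq1 : (1 + α) / 2 ≤ q) (hq2 : 1 - η / 2 ≤ q) (hq3 : (1 + 5 / 4 * c) / (1 + 2 * c) ≤ q)
    (hβ : 0 ≤ β) (hβc : 2 * β * b = c)
    (hdrift : ∀ x, markovTransition U P t V x ≤ V x / 8 + b)
    (hcontr : ∀ x y, d x y < 1 → (∫ ω, d (T₁ x y ω) (T₂ x y ω) ∂P₁) ≤ α * d x y)
    (hsmall : ∀ x y, V x ≤ 4 * b → V y ≤ 4 * b → (∫ ω, d (T₃ x y ω) (T₄ x y ω) ∂P₂) ≤ 1 - η)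
    {A : ℝ} (hA : 0 ≤ A) {g : X → ℝ}
    (hg : Measurable g ∧ (∀ x, |g x| ≤ 1) ∧ ∀ x y, |g x - g y| ≤ A * Real.sqrt (d x y * (1 + β * V x + β * V y))) :
    Measurable (markovTransition U P t g) ∧ (∀ x, |markovTransition U P t g x| ≤ 1) ∧
      ∀ x y, |markovTransition U P t g x - markovTransition U P t g y| ≤
        (Real.sqrt q * A) * Real.sqrt (d x y * (1 + β * V x + β * V y)) := by
  refine ⟨measurable_markovTransition' U P t hU hg.1, fun x => abs_markovTransition_le U P t hg.2.1 x, fun x y => ?_⟩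
  haveI := hcpl₁.1
  haveI := hcpl₂.1
  have hQx0 := markovTransition_nonneg U P t hV0 x; have hQy0 := markovTransition_nonneg U P t hV0 y
  -- expected `d` under a coupling lies in `[0, 1]`
  have hEd : ∀ {Ω' : Type} [MeasurableSpace Ω'] (P' : Measure Ω') [IsProbabilityMeasure P'] (S S' : Ω' → X),
      0 ≤ ∫ ω, d (S ω) (S' ω) ∂P' ∧ ∫ ω, d (S ω) (S' ω) ∂P' ≤ 1 := by
    intro Ω' _ P' _ S S'
    refine ⟨integral_nonneg fun ω => hd0 _ _, ?_⟩
    have h := norm_integral_le_of_norm_le_const (μ := P') (f := fun ω => d (S ω) (S' ω)) (C := 1)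
      (Eventually.of_forall fun ω => by
        rw [Real.norm_eq_abs, abs_of_nonneg (hd0 _ _)]; exact hd1 _ _)
    rw [Real.norm_eq_abs] at h
    simpa using (le_abs_self _).trans h
  -- the bound `A √(E d · (1 + βQVx + βQVy)) ≤ √q A √(d (1 + βVx + βVy))` from the case arithmetic
  have hfinish : ∀ e : ℝ, e * (1 + β * markovTransition U P t V x + β * markovTransition U P t V y) ≤
      q * (d x y * (1 + β * V x + β * V y)) →
      A * Real.sqrt (e * (1 + β * markovTransition U P t V x + β * markovTransition U P t V y)) ≤
        (Real.sqrt q * A) * Real.sqrt (d x y * (1 + β * V x + β * V y)) := by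
    intro e he
    calc A * Real.sqrt (e * (1 + β * markovTransition U P t V x + β * markovTransition U P t V y))
        ≤ A * Real.sqrt (q * (d x y * (1 + β * V x + β * V y))) := mul_le_mul_of_nonneg_left (Real.sqrt_le_sqrt he) hA
      _ = (Real.sqrt q * A) * Real.sqrt (d x y * (1 + β * V x + β * V y)) := by rw [Real.sqrt_mul hq0]; ring
  by_cases hlt : d x y < 1
  · have hb1 := coupling_lipschitz_bound U P t P₁ T₁ T₂ hcpl₁ hVm hV0 hVM hdm hd0 hd1 hβ hA hg.1 hg.2.1 hg.2.2 x y
    obtain ⟨he0, he1⟩ := hEd P₁ (fun ω => T₁ x y ω) (fun ω => T₂ x y ω)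
    exact hb1.trans (hfinish _ (hms_case_arith hα0 hα1 hc0 hcα hcη hq1 hq2 hq3 hβ hβc (hV0 x) (hV0 y) (hdrift x)
      (hdrift y) hQx0 hQy0 he0 he1 (hd0 x y) (Or.inl ⟨hlt, hcontr x y hlt⟩)))
  · have hdxy : d x y = 1 := le_antisymm (hd1 x y) (not_lt.1 hlt)
    by_cases hS : 4 * b ≤ V x + V y
    · have hb1 := coupling_lipschitz_bound U P t P₁ T₁ T₂ hcpl₁ hVm hV0 hVM hdm hd0 hd1 hβ hA hg.1 hg.2.1 hg.2.2 x y
      obtain ⟨he0, he1⟩ := hEd P₁ (fun ω => T₁ x y ω) (fun ω => T₂ x y ω)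
      exact hb1.trans (hfinish _ (hms_case_arith hα0 hα1 hc0 hcα hcη hq1 hq2 hq3 hβ hβc (hV0 x) (hV0 y) (hdrift x)
        (hdrift y) hQx0 hQy0 he0 he1 (hd0 x y) (Or.inr ⟨hdxy, Or.inl hS⟩)))
    · have hVx : V x ≤ 4 * b := by linarith [hV0 y, not_le.1 hS]
      have hVy : V y ≤ 4 * b := by linarith [hV0 x, not_le.1 hS]
      have hb2 := coupling_lipschitz_bound U P t P₂ T₃ T₄ hcpl₂ hVm hV0 hVM hdm hd0 hd1 hβ hA hg.1 hg.2.1 hg.2.2 x y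
      obtain ⟨he0, he1⟩ := hEd P₂ (fun ω => T₃ x y ω) (fun ω => T₄ x y ω)
      exact hb2.trans (hfinish _ (hms_case_arith hα0 hα1 hc0 hcα hcη hq1 hq2 hq3 hβ hβc (hV0 x) (hV0 y) (hdrift x)
        (hdrift y) hQx0 hQy0 he0 he1 (hd0 x y) (Or.inr ⟨hdxy, Or.inr (hsmall x y hVx hVy)⟩)))

/-- **`WeakHarrisOneStep` (item stmt-QuantumFields-27870) holds**: the one-step weak Harris theorem in dual
(Lipschitz) form with constants `β = c/(2b)`, `κ = √q`, `c = min(1/2, (1−α)/2, η/2)`,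
`q = max((1+α)/2, 1 − η/2, (1 + 5c/4)/(1 + 2c))` (`contraction_step`, iterated; `lyapunov_iterate`).
[cite: HairerMattinglyScheutzow2011, Theorem 4.8 and its proof] -/
theorem weakHarrisOneStep_proof : Summit.QuantumFields.YangMills.Theses.TransportPerturbation.WeakHarrisOneStep := by
  unfold Summit.QuantumFields.YangMills.Theses.TransportPerturbation.WeakHarrisOneStep
  intro α η b hα0 hα1 hη hb
  set c : ℝ := min (1 / 2) (min ((1 - α) / 2) (η / 2)) with hc
  have hc0 : 0 < c := lt_min (by norm_num) (lt_min (by linarith) (by linarith))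
  have hcα : c ≤ (1 - α) / 2 := (min_le_right _ _).trans (min_le_left _ _); have hcη : c ≤ η / 2 := (min_le_right _ _).trans (min_le_right _ _)
  set q : ℝ := max ((1 + α) / 2) (max (1 - η / 2) ((1 + 5 / 4 * c) / (1 + 2 * c))) with hq
  have hq1 : (1 + α) / 2 ≤ q := le_max_left _ _; have hq2 : 1 - η / 2 ≤ q := (le_max_left _ _).trans (le_max_right _ _)
  have hq3 : (1 + 5 / 4 * c) / (1 + 2 * c) ≤ q := (le_max_right _ _).trans (le_max_right _ _); have hq0 : 0 ≤ q := by linarith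
  have hqlt : q < 1 := by
    refine max_lt (by linarith) (max_lt (by linarith) ?_)
    rw [div_lt_one (by linarith)]
    linarith
  have hβ0 : 0 < c / (2 * b) := by positivity
  have hβc : 2 * (c / (2 * b)) * b = c := by field_simp
  refine ⟨c / (2 * b), Real.sqrt q, hβ0, Real.sqrt_nonneg q, ?_, ?_⟩
  · calc Real.sqrt q < Real.sqrt 1 := Real.sqrt_lt_sqrt hq0 hqlt
      _ = 1 := Real.sqrt_one
  intro X Ω Ω₁ Ω₂ _ _ _ _ P _ U t hU P₁ T₁ T₂ P₂ T₃ T₄ hcpl₁ hcpl₂ V d hVm hV0 hVM hdm hd0 hd1 hdrift hcontr hsmall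
  obtain ⟨M, hVM⟩ := hVM
  refine ⟨fun m x => ?_, fun m => ?_⟩
  · obtain ⟨hm, h0, hbd⟩ := lyapunov_iterate U P t hU hVm hV0 hVM hb.le hdrift m
    refine ⟨hm, h0 x, (hbd x).trans (add_le_add ?_ ?_)⟩
    · exact div_le_self (hV0 x) (one_le_pow₀ (by norm_num))
    · have h8 : (0 : ℝ) < 8 ^ m := by positivity
      have : 8 * b / 7 * (1 - 1 / 8 ^ m) ≤ 8 * b / 7 * 1 :=
        mul_le_mul_of_nonneg_left (by rw [sub_le_self_iff]; positivity) (by positivity)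
      linarith
  · induction m with
    | zero =>
      intro A g _ hg
      simpa using hg
    | succ n ih =>
      intro A g hA hg
      have hstep := contraction_step U P t hU P₁ T₁ T₂ P₂ T₃ T₄ hcpl₁ hcpl₂ hVm hV0 hVM hdm hd0 hd1 hα0 hα1.le hc0 hcα
        hcη hq0 hq1 hq2 hq3 hβ0.le hβc hdrift hcontr hsmall hA hg
      have hih := ih (Real.sqrt q * A) (markovTransition U P t g) (by positivity) hstep
      rw [Function.iterate_succ_apply]
      refine ⟨hih.1, hih.2.1, fun x y => (hih.2.2 x y).trans_eq ?_⟩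
      ring

end Summit.QuantumFields.YangMills.Theorems.TransportPerturbation

end
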